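import Summits.AtomisticToContinuum.FouriersLaw.Theorems.PhononMeanFreePathIncoherentBoundedDissipation
import Summits.AtomisticToContinuum.FouriersLaw.Theorems.PhononMeanFreePathIncoherentBoundedFixedN
import Summits.AtomisticToContinuum.FouriersLaw.Theorems.JunctionLocalitySuperadditiveResistanceStubBypassBoundAux2
import Mathlib.Analysis.Calculus.LineDeriv.IntegrationByParts

/-!
# `PhononMeanFreePath.IncoherentBounded` — the `N`-uniform coherent (Landauer-type) bound

Helper file for item `stmt-AtomisticToContinuum-11815` (support `IncoherentBounded`, route `PhononMeanFreePath`,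
sub-problem `FouriersLaw`). The item's sequence is `a_N = N (γ²/T²) ∫_{t>0} (C_N(t) - 2 r_N(t)²) dt` with the
end-to-end momentum pair correlation `r_N(t) = ∫ p₀ (K_t p_N) dμ₀` of the `(N+1)`-site pinned anharmonic chain at
equilibrium (`μ₀ = μ_T` the Gibbs measure, `K_t` the constructed transition kernels). This file proves the first
`N`-UNIFORM estimate on these objects in the tree:

* `integral_snd_mul_eq_integral_partialP` — Gaussian integration by parts `∫ p_j u dμ_T = T ∫ ∂_{p_j} u dμ_T` for
  differentiable bounded `u` with `∂_{p_j} u ∈ L¹(μ_T)` (no support condition);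
* `ofReal_sq_integral_snd_mul_forecast_le` — the pointwise coherent bound
  `(∫ p_j K_s F dμ_T)² ≤ T² ∫ (∂_{p_j} K_s F)² dμ_T` (`F ∈ C_c`, `s > 0`; smooth forecasts by hypoellipticity);
* `lintegral_sq_integral_snd_mul_forecast_le` — with the dissipation inequality (file `…Dissipation`):
  `∫_{s>0} (∫ p_0 K_s F dμ_T)² ds ≤ (T/(2γ)) ∫ F² dμ_T`;
* `lintegral_rN_sq_le`, `integral_rN_sq_le` — truncation `F_k = χ_k p_N → p_N`, dominated convergence and Fatou:

    `∫_{t>0} r_N(t)² dt ≤ T²/(2γ)` for every `N`;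

* `coherent_term_le_linear` — in the item's normalisation, `N (γ²/T²) · 2∫_{t>0} r_N² ≤ γ N`.

So the coherent channel of `a_N` is at most linear in `N` with an explicit uniform constant; `a_N = O(1)` itself
needs the `O(1/N)` bound on the total conductance `(γ²/T²) ∫_{t>0} C_N`, the open upper half of Fourier's law
for the anharmonic pinned chain. No definitions.
-/

noncomputable section

open MeasureTheory ProbabilityTheory Filter Topology Set
open scoped NNReal ENNReal ContDiff
open Literature.MathematicalPhysics.KineticTheory.HeatConduction
open Literature.MathematicalPhysics.KineticTheory Literature.Probability.Process OscillatorChain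

namespace Summit.AtomisticToContinuum.FouriersLaw.Theorems.IncoherentBounded

variable {N : ℕ}

/-! ## 6. Gaussian integration by parts under `μ_T` and the pointwise coherent bound -/

section Coherent

open Summit.AtomisticToContinuum.FouriersLaw.Theorems.SubdiffusiveBondHeat
open Summit.AtomisticToContinuum.FouriersLaw.Cruxes.SuperadditiveResistance.FloatingProbeBypassLaplacian

variable {ω₂ lam β γ : ℝ} (hω : 0 < ω₂) (hl : 0 ≤ lam) (hβ : 0 < β) (hγ : 0 < γ)
  (hN : 0 < N) {T : ℝ} (hT : 0 < T)
include hω hl hβ hγ hN hT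

omit hγ hN in
/-- **Gaussian integration by parts in the momentum `p_j` under the Gibbs measure**, for a differentiable
bounded `u` whose partial derivative `∂_{p_j} u` is `μ_T`-integrable (no support condition):
`∫ p_j u dμ_T = T ∫ ∂_{p_j} u dμ_T` (`p_j e^{-H/T} = -T ∂_{p_j} e^{-H/T}` and Mathlib's integration by parts
for integrable products along the line `(0, e_j)`). [folklore] -/
theorem integral_snd_mul_eq_integral_partialP (j : Fin N) {u : PhaseSpace N → ℝ} (hu : Differentiable ℝ u)
    {M : ℝ} (hM : ∀ x, |u x| ≤ M)
    (hdu : Integrable (partialP j u) ((pinnedChain ω₂ lam β γ).gibbsMeasure N T)) :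
    ∫ x, x.2 j * u x ∂((pinnedChain ω₂ lam β γ).gibbsMeasure N T) =
      T * ∫ x, partialP j u x ∂((pinnedChain ω₂ lam β γ).gibbsMeasure N T) := by
  set P := pinnedChain ω₂ lam β γ with hP
  haveI : IsProbabilityMeasure (P.gibbsMeasure N T) :=
    pinnedChain_isProbabilityMeasure_gibbsMeasure hω hl hβ.le γ N hT
  have huc : Continuous u := hu.continuous
  -- integrability under `μ_T`
  have hpj : MemLp (fun x : PhaseSpace N => x.2 j) 2 (P.gibbsMeasure N T) :=
    pinnedChain_memLp_two_snd hω hl hβ.le γ N hT j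
  have hu2 : MemLp u 2 (P.gibbsMeasure N T) :=
    memLp_of_bounded (a := -M) (b := M) (Eventually.of_forall fun x => abs_le.1 (hM x))
      huc.aestronglyMeasurable 2
  have hu1 : Integrable u (P.gibbsMeasure N T) := hu2.integrable one_le_two
  have hpu : Integrable (fun x => x.2 j * u x) (P.gibbsMeasure N T) := hpj.integrable_mul hu2
  -- the same against `e^{-H/T} dx`
  have i0 := integrable_mul_gibbsDensity_of_integrable hω hl hβ.le γ N hT hu1
  have i1 := integrable_mul_gibbsDensity_of_integrable hω hl hβ.le γ N hT hpu
  have i2 := integrable_mul_gibbsDensity_of_integrable hω hl hβ.le γ N hT hdu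
  -- integration by parts along `(0, e_j)` against the Gibbs density
  haveI := isAddHaarMeasure_volume_phaseSpace N
  have e := integral_bilinear_hasLineDerivAt_right_eq_neg_left_of_integrable
    (μ := (volume : Measure (PhaseSpace N))) (B := ContinuousLinearMap.mul ℝ ℝ)
    (f := u) (f' := partialP j u) (g := P.gibbsDensity N T)
    (g' := fun x => -(x.2 j / T) * P.gibbsDensity N T x)
    (v := ((0, Pi.single j 1) : PhaseSpace N)) ?_ ?_ ?_ (fun x _ => hasLineDerivAt_partialP hu j x)
    (fun x _ => P.hasLineDerivAt_gibbsDensity (P.hasLineDerivAt_hamiltonian_unitP N x j))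
  · simp only [ContinuousLinearMap.mul_apply'] at e
    have e1 : ∫ x, u x * (-(x.2 j / T) * P.gibbsDensity N T x) =
        -T⁻¹ * ∫ x, x.2 j * u x * P.gibbsDensity N T x := by
      rw [← integral_const_mul]
      refine integral_congr_ae (ae_of_all _ fun x => ?_)
      simp only
      field_simp
    rw [e1] at e
    have e2 : ∫ x, x.2 j * u x * P.gibbsDensity N T x = T * ∫ x, partialP j u x * P.gibbsDensity N T x := by
      have hTT : T * T⁻¹ = 1 := mul_inv_cancel₀ hT.ne'
      calc ∫ x, x.2 j * u x * P.gibbsDensity N T x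
          = -T * (-T⁻¹ * ∫ x, x.2 j * u x * P.gibbsDensity N T x) := by
            rw [← mul_assoc, show -T * -T⁻¹ = T * T⁻¹ by ring, hTT, one_mul]
        _ = -T * -∫ x, partialP j u x * P.gibbsDensity N T x := by rw [e]
        _ = T * ∫ x, partialP j u x * P.gibbsDensity N T x := by ring
    rw [P.integral_gibbsMeasure, P.integral_gibbsMeasure, e2]
    ring
  · simp only [ContinuousLinearMap.mul_apply']
    exact i2
  · simp only [ContinuousLinearMap.mul_apply']
    have : Integrable (fun x => -T⁻¹ * (x.2 j * u x * P.gibbsDensity N T x)) := i1.const_mul _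
    refine this.congr (ae_of_all _ fun x => ?_)
    simp only
    field_simp
  · simp only [ContinuousLinearMap.mul_apply']
    exact i0

omit hω hl hβ hγ hN hT in
/-- A continuous function with finite `∫⁻ ofReal (g²)` for a finite measure is square-integrable and
integrable. [folklore] -/
theorem integrable_sq_of_lintegral_lt_top {ν : Measure (PhaseSpace N)} [IsFiniteMeasure ν]
    {g : PhaseSpace N → ℝ} (hg : Continuous g) (hfin : ∫⁻ x, ENNReal.ofReal (g x ^ 2) ∂ν < ⊤) :
    Integrable (fun x => g x ^ 2) ν ∧ Integrable g ν := by
  have hI2 : Integrable (fun x => g x ^ 2) ν :=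
    ⟨(hg.pow 2).aestronglyMeasurable, (hasFiniteIntegral_iff_ofReal (ae_of_all _ fun x => sq_nonneg _)).2 hfin⟩
  exact ⟨hI2, ((memLp_two_iff_integrable_sq hg.aestronglyMeasurable).2 hI2).integrable one_le_two⟩

omit hN in
/-- **The pointwise coherent bound.** For `F ∈ C_c(Ω)`, `s > 0`, `u_s = K_s F` and any momentum index `j`:
`(∫ p_j u_s dμ_T)² ≤ T² ∫ (∂_{p_j} u_s)² dμ_T`, stated with a lower Lebesgue integral on the right (trivial
when it is infinite; otherwise Gaussian integration by parts `∫ p_j u_s dμ_T = T ∫ ∂_{p_j} u_s dμ_T` and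
Jensen). [folklore] -/
theorem ofReal_sq_integral_snd_mul_forecast_le (hN' : 0 < N) (j : Fin N) {F : PhaseSpace N → ℝ}
    (hFc : Continuous F) (hFs : HasCompactSupport F) {s : ℝ} (hs : 0 < s) :
    ENNReal.ofReal ((∫ x, x.2 j *
        (∫ y, F y ∂((pinnedChain ω₂ lam β γ).transitionKernel N T T s.toNNReal x))
          ∂((pinnedChain ω₂ lam β γ).gibbsMeasure N T)) ^ 2) ≤
      ENNReal.ofReal (T ^ 2) * ∫⁻ x, ENNReal.ofReal (partialP j
        (fun z => ∫ y, F y ∂((pinnedChain ω₂ lam β γ).transitionKernel N T T s.toNNReal z)) x ^ 2)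
          ∂((pinnedChain ω₂ lam β γ).gibbsMeasure N T) := by
  set P := pinnedChain ω₂ lam β γ with hP
  set μ := P.gibbsMeasure N T with hμ
  haveI : IsProbabilityMeasure μ := pinnedChain_isProbabilityMeasure_gibbsMeasure hω hl hβ.le γ N hT
  haveI hMK : ∀ t, IsMarkovKernel (P.transitionKernel N T T t) := fun t =>
    pinnedChain_isMarkovKernel_transitionKernel hω hl hβ.le hγ.le N T T t
  set u : PhaseSpace N → ℝ := fun z => ∫ y, F y ∂(P.transitionKernel N T T s.toNNReal z) with hu
  have hu2 : ContDiff ℝ 2 u := contDiff_forecast hω hl hγ hN' hβ.le hT hT.le hFc hFs hs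
  have hud : Differentiable ℝ u := hu2.differentiable two_ne_zero
  obtain ⟨M, hM⟩ : ∃ M, ∀ x, ‖F x‖ ≤ M := hFc.bounded_above_of_compact_support hFs
  have hM' : ∀ z, |F z| ≤ M := fun z => by rw [← Real.norm_eq_abs]; exact hM z
  have hub : ∀ x, |u x| ≤ M := fun x =>
    (integrable_and_abs_integral_le (ν := P.transitionKernel N T T s.toNNReal x) hFc.measurable hM').2
  have hduc : Continuous (partialP j u) := continuous_partialP hu2 two_ne_zero j
  show ENNReal.ofReal ((∫ x, x.2 j * u x ∂μ) ^ 2) ≤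
    ENNReal.ofReal (T ^ 2) * ∫⁻ x, ENNReal.ofReal (partialP j u x ^ 2) ∂μ
  by_cases hfin : ∫⁻ x, ENNReal.ofReal (partialP j u x ^ 2) ∂μ = ⊤
  · rw [hfin, ENNReal.mul_top (ENNReal.ofReal_pos.2 (by positivity)).ne']
    exact le_top
  obtain ⟨hI2, hI1⟩ := integrable_sq_of_lintegral_lt_top hduc (lt_top_iff_ne_top.2 hfin)
  have hibp := integral_snd_mul_eq_integral_partialP hω hl hβ hT j hud hub hI1
  have hj := sq_integral_le_integral_sq hI1 hI2
  rw [hibp, mul_pow, ← ofReal_integral_eq_lintegral_ofReal hI2 (ae_of_all _ fun x => sq_nonneg _),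
    ← ENNReal.ofReal_mul (sq_nonneg T)]
  exact ENNReal.ofReal_le_ofReal (mul_le_mul_of_nonneg_left hj (sq_nonneg T))

/-- **The integrated coherent bound for a compactly supported observable.** For `F ∈ C_c(Ω)`:

  `∫_{s>0} (∫ p_0 K_s F dμ_T)² ds ≤ (T/(2γ)) ∫ F² dμ_T`

(lower Lebesgue integral on the left): the pointwise coherent bound, `2γT (∂_{p_0} u)² ≤ 2Γ(u)`, and the
dissipation inequality `dissipation_lintegral_le'`. [folklore] -/
theorem lintegral_sq_integral_snd_mul_forecast_le {F : PhaseSpace N → ℝ} (hFc : Continuous F)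
    (hFs : HasCompactSupport F) :
    ∫⁻ s in Ioi (0 : ℝ), ENNReal.ofReal ((∫ x, x.2 ⟨0, hN⟩ *
        (∫ y, F y ∂((pinnedChain ω₂ lam β γ).transitionKernel N T T s.toNNReal x))
          ∂((pinnedChain ω₂ lam β γ).gibbsMeasure N T)) ^ 2) ≤
      ENNReal.ofReal (T / (2 * γ) * ∫ x, F x ^ 2 ∂((pinnedChain ω₂ lam β γ).gibbsMeasure N T)) := by
  set P := pinnedChain ω₂ lam β γ with hP
  set μ := P.gibbsMeasure N T with hμ
  set j₀ : Fin N := ⟨0, hN⟩ with hj₀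
  set U : ℝ → PhaseSpace N → ℝ := fun s z => ∫ y, F y ∂(P.transitionKernel N T T s.toNNReal z) with hU
  -- the dissipation inequality and the comparison `2γT (∂_{p_0} u)² ≤ 2Γ(u)`
  have hD := dissipation_lintegral_le' hω hl hβ hγ hN hT hFc hFs
  set X : ℝ≥0∞ := ∫⁻ s in Ioi (0 : ℝ), ∫⁻ x, ENNReal.ofReal (partialP j₀ (U s) x ^ 2) ∂μ with hX
  have hw : T ≤ (if j₀.val = 0 then T else 0) + (if j₀.val = N - 1 then T else 0) := by
    rw [if_pos (show j₀.val = 0 from rfl)]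
    split_ifs <;> linarith [hT.le]
  have hpt : ∀ s x, ENNReal.ofReal (2 * γ * T) * ENNReal.ofReal (partialP j₀ (U s) x ^ 2) ≤
      ENNReal.ofReal (2 * (γ * ∑ i : Fin N,
        ((if i.val = 0 then T else 0) + (if i.val = N - 1 then T else 0)) * partialP i (U s) x ^ 2)) := by
    intro s x
    rw [← ENNReal.ofReal_mul (by positivity)]
    refine ENNReal.ofReal_le_ofReal ?_
    have hsum : ((if j₀.val = 0 then T else 0) + (if j₀.val = N - 1 then T else 0)) * partialP j₀ (U s) x ^ 2 ≤
        ∑ i : Fin N, ((if i.val = 0 then T else 0) + (if i.val = N - 1 then T else 0)) * partialP i (U s) x ^ 2 :=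
      Finset.single_le_sum (f := fun i : Fin N =>
        ((if i.val = 0 then T else 0) + (if i.val = N - 1 then T else 0)) * partialP i (U s) x ^ 2)
        (fun i _ => mul_nonneg (add_nonneg (by split_ifs <;> linarith [hT.le]) (by split_ifs <;> linarith [hT.le]))
          (sq_nonneg _)) (Finset.mem_univ j₀)
    have h1 : T * partialP j₀ (U s) x ^ 2 ≤
        ((if j₀.val = 0 then T else 0) + (if j₀.val = N - 1 then T else 0)) * partialP j₀ (U s) x ^ 2 :=
      mul_le_mul_of_nonneg_right hw (sq_nonneg _)
    nlinarith [hγ.le]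
  have hkey : ENNReal.ofReal (2 * γ * T) * X ≤ ENNReal.ofReal (∫ x, F x ^ 2 ∂μ) := by
    refine le_trans ?_ hD
    rw [hX, ← lintegral_const_mul' _ _ ENNReal.ofReal_ne_top]
    refine lintegral_mono fun s => ?_
    rw [← lintegral_const_mul' _ _ ENNReal.ofReal_ne_top]
    exact lintegral_mono fun x => hpt s x
  -- the pointwise coherent bound, integrated
  have hpw : ∫⁻ s in Ioi (0 : ℝ), ENNReal.ofReal ((∫ x, x.2 j₀ * U s x ∂μ) ^ 2) ≤ ENNReal.ofReal (T ^ 2) * X := by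
    rw [hX, ← lintegral_const_mul' _ _ ENNReal.ofReal_ne_top]
    refine setLIntegral_mono' measurableSet_Ioi fun s hs => ?_
    exact ofReal_sq_integral_snd_mul_forecast_le hω hl hβ hγ hT hN j₀ hFc hFs hs
  calc ∫⁻ s in Ioi (0 : ℝ), ENNReal.ofReal ((∫ x, x.2 j₀ * U s x ∂μ) ^ 2)
      ≤ ENNReal.ofReal (T ^ 2) * X := hpw
    _ = ENNReal.ofReal (T / (2 * γ)) * (ENNReal.ofReal (2 * γ * T) * X) := by
        rw [← mul_assoc, ← ENNReal.ofReal_mul (by positivity)]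
        congr 2
        rw [div_mul_eq_mul_div, eq_div_iff (by positivity)]
        ring
    _ ≤ ENNReal.ofReal (T / (2 * γ)) * ENNReal.ofReal (∫ x, F x ^ 2 ∂μ) := by gcongr
    _ = ENNReal.ofReal (T / (2 * γ) * ∫ x, F x ^ 2 ∂μ) := by rw [← ENNReal.ofReal_mul (by positivity)]

end Coherent

/-! ## 7. The coherent (Landauer-type) bound for the item's pair correlation `r_N` -/

section Item

open Summit.AtomisticToContinuum.FouriersLaw.Theorems.SubdiffusiveBondHeat

variable {ω₂ lam β γ : ℝ} (hω : 0 < ω₂) (hl : 0 ≤ lam) (hβ : 0 < β) (hγ : 0 < γ) {T : ℝ} (hT : 0 < T)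
include hω hl hβ hγ hT

/-- **The `N`-uniform coherent bound, lower-integral form.** For every `N`,

  `∫_{t>0} r_N(t)² dt ≤ T²/(2γ)`,  `r_N(t) = ∫ p₀ (K_t p_N) dμ₀`

(`μ₀` the Gibbs measure of the `(N+1)`-site pinned chain at temperature `T`, `K_t` the constructed kernels):
truncate `p_N` to `F_k = χ_k p_N ∈ C_c` (`χ_k` smooth bumps increasing to `1`), apply
`lintegral_sq_integral_snd_mul_forecast_le` (`∫ F_k² dμ₀ ≤ ∫ p_N² dμ₀ = T`), pass to the limit inside `r`
by dominated convergence (twice) and conclude by Fatou's lemma in `t`. [folklore] -/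
theorem lintegral_rN_sq_le (N : ℕ) :
    ∫⁻ t in Ioi (0 : ℝ), ENNReal.ofReal ((∫ z, z.2 0 *
        (∫ y, y.2 (Fin.last N) ∂((pinnedChain ω₂ lam β γ).transitionKernel (N + 1) T T t.toNNReal z))
          ∂((pinnedChain ω₂ lam β γ).gibbsMeasure (N + 1) T)) ^ 2) ≤
      ENNReal.ofReal (T ^ 2 / (2 * γ)) := by
  set P := pinnedChain ω₂ lam β γ with hP
  set μ := P.gibbsMeasure (N + 1) T with hμ
  haveI : IsProbabilityMeasure μ := pinnedChain_isProbabilityMeasure_gibbsMeasure hω hl hβ.le γ (N + 1) hT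
  haveI hMK : ∀ t, IsMarkovKernel (P.transitionKernel (N + 1) T T t) := fun t =>
    pinnedChain_isMarkovKernel_transitionKernel hω hl hβ.le hγ.le (N + 1) T T t
  have hNp : 0 < N + 1 := Nat.succ_pos N
  -- the truncations `F_k = χ_k · p_N`
  set pL : PhaseSpace (N + 1) → ℝ := fun y => y.2 (Fin.last N) with hpL
  have hpLc : Continuous pL := by fun_prop
  set χ : ℕ → ContDiffBump (0 : PhaseSpace (N + 1)) := fun k =>
    ⟨(k : ℝ) + 1, (k : ℝ) + 2, by positivity, by linarith⟩ with hχ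
  set Fk : ℕ → PhaseSpace (N + 1) → ℝ := fun k y => (χ k) y * pL y with hFk
  have hFkc : ∀ k, Continuous (Fk k) := fun k => (χ k).continuous.mul hpLc
  have hFks : ∀ k, HasCompactSupport (Fk k) := fun k => (χ k).hasCompactSupport.mul_right
  have hFk_le : ∀ k y, |Fk k y| ≤ |pL y| := fun k y => by
    rw [hFk]; dsimp only; rw [abs_mul, abs_of_nonneg (χ k).nonneg]
    exact mul_le_of_le_one_left (abs_nonneg _) (χ k).le_one
  have hFk_lim : ∀ y, Tendsto (fun k => Fk k y) atTop (𝓝 (pL y)) := by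
    intro y
    refine tendsto_const_nhds.congr' ?_
    obtain ⟨k₀, hk₀⟩ := exists_nat_ge ‖y‖
    filter_upwards [eventually_ge_atTop k₀] with k hk
    rw [hFk]; dsimp only
    rw [(χ k).one_of_mem_closedBall, one_mul]
    rw [Metric.mem_closedBall, dist_zero_right]
    calc ‖y‖ ≤ k₀ := hk₀
      _ ≤ k := by exact_mod_cast hk
      _ ≤ (k : ℝ) + 1 := by linarith
  -- `L²(μ₀)`-norms of the truncations: `∫ F_k² dμ₀ ≤ ∫ p_N² dμ₀ = T`
  have hϑ0 : (0 : ℝ) < 1 / (4 * T) := by positivity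
  have hϑ1 : 1 / (4 * T) < 1 / T := by
    rw [div_lt_div_iff₀ (by positivity) hT]; nlinarith
  have hexpμ := pinnedChain_integrable_exp_mul_hamiltonian_gibbsMeasure hω hl hβ.le γ (N + 1) hT hϑ1
  have hpL2 : Integrable (fun y => pL y ^ 2) μ :=
    integrable_of_abs_le_exp hexpμ (by fun_prop) (fun y => by
      rw [abs_of_nonneg (sq_nonneg _)]
      exact sq_momentum_le_exp (γ := γ) hω hl hβ.le hϑ0 y (Fin.last N))
  have hFk2 : ∀ k, ∫ y, Fk k y ^ 2 ∂μ ≤ T := by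
    intro k
    rw [← integral_momentum_sq_gibbsMeasure (γ := γ) hω hl hβ hT (N + 1) (Fin.last N)]
    refine integral_mono_of_nonneg (ae_of_all _ fun y => sq_nonneg _) hpL2 (ae_of_all _ fun y => ?_)
    show Fk k y ^ 2 ≤ y.2 (Fin.last N) ^ 2
    exact (sq_le_sq' (abs_le.1 (hFk_le k y)).1 (abs_le.1 (hFk_le k y)).2).trans (le_of_eq (sq_abs _))
  -- the approximating correlations and their limit
  set rk : ℕ → ℝ → ℝ := fun k t => ∫ z, z.2 0 *
    (∫ y, Fk k y ∂(P.transitionKernel (N + 1) T T t.toNNReal z)) ∂μ with hrk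
  set r : ℝ → ℝ := fun t => ∫ z, z.2 0 * (∫ y, pL y ∂(P.transitionKernel (N + 1) T T t.toNNReal z)) ∂μ with hr
  have hrk_bound : ∀ k, ∫⁻ t in Ioi (0 : ℝ), ENNReal.ofReal (rk k t ^ 2) ≤ ENNReal.ofReal (T ^ 2 / (2 * γ)) := by
    intro k
    refine (lintegral_sq_integral_snd_mul_forecast_le hω hl hβ hγ hNp hT (hFkc k) (hFks k)).trans ?_
    refine ENNReal.ofReal_le_ofReal ?_
    calc T / (2 * γ) * ∫ x, Fk k x ^ 2 ∂μ ≤ T / (2 * γ) * T :=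
          mul_le_mul_of_nonneg_left (hFk2 k) (by positivity)
      _ = T ^ 2 / (2 * γ) := by ring
  have hrk_meas : ∀ k, Measurable (rk k) := fun k =>
    measurable_corr hω hl hβ hγ hT (f := fun z : PhaseSpace (N + 1) => z.2 0) (by fun_prop) (hFkc k)
  -- dominated convergence inside the kernels
  have hin : ∀ (t : ℝ) (z : PhaseSpace (N + 1)),
      Tendsto (fun k => ∫ y, Fk k y ∂(P.transitionKernel (N + 1) T T t.toNNReal z)) atTop
        (𝓝 (∫ y, pL y ∂(P.transitionKernel (N + 1) T T t.toNNReal z))) := by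
    intro t z
    have hexpK := pinnedChain_integrable_exp_mul_hamiltonian_transitionKernel hω hl hT hβ.le hγ.le hNp hϑ0 hϑ1
      t.toNNReal z
    have hbd : Integrable (fun y => |pL y|) (P.transitionKernel (N + 1) T T t.toNNReal z) :=
      integrable_of_abs_le_exp hexpK (by fun_prop) (fun y => by
        rw [abs_abs]; exact abs_momentum_le_exp hω hl hβ.le hϑ0 y (Fin.last N))
    refine tendsto_integral_of_dominated_convergence (fun y => |pL y|)
      (fun k => (hFkc k).aestronglyMeasurable) hbd (fun k => ae_of_all _ fun y => ?_)
      (ae_of_all _ fun y => hFk_lim y)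
    rw [Real.norm_eq_abs]; exact hFk_le k y
  -- dominated convergence under `μ₀`
  have hout : ∀ t : ℝ, Tendsto (fun k => rk k t) atTop (𝓝 (r t)) := by
    intro t
    have hdom : Integrable (fun z : PhaseSpace (N + 1) => |z.2 0| *
        ∫ y, |pL y| ∂(P.transitionKernel (N + 1) T T t.toNNReal z)) μ :=
      integrable_mul_act hω hl hβ hγ hT (f := fun z : PhaseSpace (N + 1) => |z.2 0|) (g := fun y => |pL y|)
        (by fun_prop) (by fun_prop)
        (fun y => by rw [abs_abs]; exact abs_momentum_le_exp hω hl hβ.le hϑ0 y 0)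
        (fun y => by rw [abs_abs]; exact abs_momentum_le_exp hω hl hβ.le hϑ0 y (Fin.last N)) t.toNNReal
    refine tendsto_integral_of_dominated_convergence
      (fun z : PhaseSpace (N + 1) => |z.2 0| * ∫ y, |pL y| ∂(P.transitionKernel (N + 1) T T t.toNNReal z))
      (fun k => ?_) hdom (fun k => ae_of_all _ fun z => ?_) (ae_of_all _ fun z => (hin t z).const_mul (z.2 0))
    · exact (Continuous.aestronglyMeasurable (by fun_prop)).mul
        ((hFkc k).stronglyMeasurable.integral_kernel
          (κ := P.transitionKernel (N + 1) T T t.toNNReal)).aestronglyMeasurable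
    · rw [Real.norm_eq_abs, abs_mul]
      refine mul_le_mul_of_nonneg_left ?_ (abs_nonneg _)
      have hexpK := pinnedChain_integrable_exp_mul_hamiltonian_transitionKernel hω hl hT hβ.le hγ.le hNp hϑ0 hϑ1
        t.toNNReal z
      have hbd : Integrable (fun y => |pL y|) (P.transitionKernel (N + 1) T T t.toNNReal z) :=
        integrable_of_abs_le_exp hexpK (by fun_prop) (fun y => by
          rw [abs_abs]; exact abs_momentum_le_exp hω hl hβ.le hϑ0 y (Fin.last N))
      calc |∫ y, Fk k y ∂(P.transitionKernel (N + 1) T T t.toNNReal z)|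
          ≤ ∫ y, |Fk k y| ∂(P.transitionKernel (N + 1) T T t.toNNReal z) := abs_integral_le_integral_abs
        _ ≤ ∫ y, |pL y| ∂(P.transitionKernel (N + 1) T T t.toNNReal z) :=
          integral_mono_of_nonneg (ae_of_all _ fun y => abs_nonneg _) hbd (ae_of_all _ fun y => hFk_le k y)
  -- Fatou in `t`
  have hlim : ∀ t, liminf (fun k => ENNReal.ofReal (rk k t ^ 2)) atTop = ENNReal.ofReal (r t ^ 2) := fun t =>
    (ENNReal.tendsto_ofReal ((hout t).pow 2)).liminf_eq
  calc ∫⁻ t in Ioi (0 : ℝ), ENNReal.ofReal (r t ^ 2)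
      = ∫⁻ t in Ioi (0 : ℝ), liminf (fun k => ENNReal.ofReal (rk k t ^ 2)) atTop :=
        lintegral_congr fun t => (hlim t).symm
    _ ≤ liminf (fun k => ∫⁻ t in Ioi (0 : ℝ), ENNReal.ofReal (rk k t ^ 2)) atTop :=
        lintegral_liminf_le fun k => ((hrk_meas k).pow_const 2).ennreal_ofReal
    _ ≤ ENNReal.ofReal (T ^ 2 / (2 * γ)) :=
        liminf_le_of_frequently_le' (Frequently.of_forall fun k => hrk_bound k)

/-- **The `N`-uniform coherent (Landauer-type) bound** on the item's momentum pair correlation: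

  `∫_{t>0} r_N(t)² dt ≤ T²/(2γ)` for every `N`,

i.e. `N · 2(γ²/T²) ∫_{t>0} r_N² ≤ γ N`: the coherent part of the item's sequence `a_N` grows at most linearly,
with an explicit `N`-uniform constant (the integrability at each fixed `N` is `rN_sq_integrableOn`). This is the
only `N`-uniform estimate on the objects of `IncoherentBounded` in the tree; the full claim `a_N = O(1)` needs
the (open) `O(1/N)` bound on the total conductance. [folklore] -/
theorem integral_rN_sq_le (N : ℕ) :
    ∫ t in Ioi (0 : ℝ), (∫ z, z.2 0 *
        (∫ y, y.2 (Fin.last N) ∂((pinnedChain ω₂ lam β γ).transitionKernel (N + 1) T T t.toNNReal z))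
          ∂((pinnedChain ω₂ lam β γ).gibbsMeasure (N + 1) T)) ^ 2 ≤ T ^ 2 / (2 * γ) := by
  have hi := rN_sq_integrableOn hω hl hβ hγ hT N
  rw [integral_eq_lintegral_of_nonneg_ae (ae_of_all _ fun t => sq_nonneg _) hi.aestronglyMeasurable]
  exact ENNReal.toReal_le_of_le_ofReal (by positivity) (lintegral_rN_sq_le hω hl hβ hγ hT N)

/-- The same bound in the item's normalisation: `N · (γ²/T²) · 2 ∫_{t>0} r_N² ≤ γ N` for every `N` — the
coherent contribution to `a_N` is at most linear in `N`, uniformly in all parameters but `γ`. [folklore] -/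
theorem coherent_term_le_linear (N : ℕ) :
    (N : ℝ) * (γ ^ 2 / T ^ 2) * (2 * ∫ t in Ioi (0 : ℝ), (∫ z, z.2 0 *
        (∫ y, y.2 (Fin.last N) ∂((pinnedChain ω₂ lam β γ).transitionKernel (N + 1) T T t.toNNReal z))
          ∂((pinnedChain ω₂ lam β γ).gibbsMeasure (N + 1) T)) ^ 2) ≤ γ * N := by
  have h := integral_rN_sq_le hω hl hβ hγ hT N
  have hN0 : (0 : ℝ) ≤ N := N.cast_nonneg
  have h1 : (γ ^ 2 / T ^ 2) * (2 * ∫ t in Ioi (0 : ℝ), (∫ z, z.2 0 *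
        (∫ y, y.2 (Fin.last N) ∂((pinnedChain ω₂ lam β γ).transitionKernel (N + 1) T T t.toNNReal z))
          ∂((pinnedChain ω₂ lam β γ).gibbsMeasure (N + 1) T)) ^ 2) ≤ γ := by
    calc (γ ^ 2 / T ^ 2) * (2 * _) ≤ (γ ^ 2 / T ^ 2) * (2 * (T ^ 2 / (2 * γ))) := by gcongr
      _ = γ := by field_simp
  calc (N : ℝ) * (γ ^ 2 / T ^ 2) * (2 * _) = (N : ℝ) * ((γ ^ 2 / T ^ 2) * (2 * _)) := by ring
    _ ≤ (N : ℝ) * γ := mul_le_mul_of_nonneg_left h1 hN0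
    _ = γ * N := by ring

end Item

end Summit.AtomisticToContinuum.FouriersLaw.Theorems.IncoherentBounded
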